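import Summits.NavierStokesRegularity.NavierStokesRegularity.Theorems.CoreLogGasBlowupIsLocallyDrivenRateReduction
import Summits.NavierStokesRegularity.NavierStokesRegularity.Theorems.CoreLogGasBlowupIsLocallyDrivenShellStretchingDepletion

/-!
# Crux `CoreLogGas.BlowupIsLocallyDriven` (stmt-NavierStokesRegularity-11291): the rate-form crux from DIRECTION
# COHERENCE across the shell

`--supports stmt-NavierStokesRegularity-11291` (lead `prover-line-stmt-NavierStokesRegularity-11291-c5-0`, 2026-08-17).

The re-typed crux `B_rate2` (lead c4, `Cruxes/BlowupIsLocallyDriven/RestatementC4.lean`; its text is the conclusion of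
the landed `Rate.bRate_of_shellRate`, p158280) is equivalent to rate-form shell locality `ShellRate2` (p159075):
for all `M ≥ 1`, at admissible `(t, x, ρ)` with `Mρ ≤ R`, the symmetric gradient `D_shell` induced at the peak by the
vorticity in the shell `B(x,R) ∖ B(x,Mρ)` is at most `C/M² · Ω(t) + g₁(t)`. By the depletion of the shell stretching
(`Depletion.shellStretch_abs_le_depleted`, `Depletion.shellStretch_abs_le_rate`, this crux's ShellStretchingDepletion
file) the quadratic form `⟪D_shell e, e⟫` sees only the vorticity component ORTHOGONAL to `e`. This file records the
two resulting reductions of the re-typed crux to statements about the SHAPE of the vorticity across the shell, slice by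
slice in time (no time integration against `∫Ω = ∞`):

* `shellRate_of_shellCoherence` (registered stub) — **pointwise coherence ⇒ `ShellRate2`**: if at admissible peaks the
  component of `ω(t,y)` orthogonal to `e` decays quadratically in core units across the shell,
  `‖ω(t,y) − ⟪ω(t,y),e⟫e‖ ≤ c ρ² Ω(t) |x − y|⁻²` for `Mρ ≤ |y − x| < R`, then `ShellRate2` holds with `C = C₀ c`, `g₁ = 0`
  (isolated cores with a quadratically decaying halo; for `e = ξ(t,x)` also straight tubes, antiparallel pairs and
  unidirectional layers through the peak);
* `shellRate_of_depletedShellRate` (registered stub) — **depleted integral rate ⇒ `ShellRate2`**: it suffices to bound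
  the DEPLETED shell integral `∫_shell ‖ω_⊥e(t,y)‖ |x − y|⁻³ dy` by `C/M² · Ω(t) + g₁(t)` (the sharp form: a smoothly
  curved tube violates the pointwise hypothesis far along its axis but passes this one, its core subtending a solid angle
  `∼ (ρ/|x−y|)²`);
* `bRate_of_shellCoherence`, `bRate_of_depletedShellRate` — composed with `Rate.bRate_of_shellRate`: either hypothesis
  gives the re-typed crux `B_rate2` verbatim.

What fails both hypotheses is direction-DISORDERED shell vorticity of full size `Ω(t)` at distances `≫ ρ` — the
collapsing sheet / radial "hedgehog" pancake (Hou's scenario) that the route's docstring declares to be B's failure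
mode; so under the re-typing the load-bearing content of B is the Constantin–Fefferman coherence of the vorticity
direction at the scale of the core, as leads c3/c4 argued informally.
-/

noncomputable section

open Set MeasureTheory Filter Topology Metric
open scoped ContDiff

-- justification: the namespace is fixed by the crux protocol (sibling files of this crux use `…Theorems.BlowupIsLocallyDriven.*`).
set_option linter.dupNamespace false

namespace Summit.NavierStokesRegularity.NavierStokesRegularity.Theorems.BlowupIsLocallyDriven.Depletion

open Literature.Analysis.FluidPDE
open Summit.NavierStokesRegularity.NavierStokesRegularity.Theorems.BlowupIsLocallyDriven.Rate

/-- **Pointwise direction coherence across the shell ⇒ rate-form shell locality (registered stub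
`shellRate_of_shellCoherence`).** If every maximal finite-energy classical solution from Clay data admits `c ≥ 0`,
`t₀ < T`, `R > 0` such that for all `M ≥ 1`, at every admissible `(t,x,ρ)` with `Mρ ≤ R` and every unit `e`, the
component of `ω(t,y)` orthogonal to `e` is at most `c ρ² Ω(t) |x − y|⁻²` across the shell `B(x,R) ∖ B(x,Mρ)`, then
`ShellRate2` (the hypothesis of `Rate.bRate_of_shellRate`) holds with `C = C₀ c` and `g₁ = 0`
(`Depletion.shellStretch_abs_le_rate` at `v = u(t)`, `m = c Ω(t)`). [folklore] -/
theorem shellRate_of_shellCoherence : (∀ (ν T : ℝ), 0 < ν → 0 < T → ∀ (u : ℝ → EuclideanSpace ℝ (Fin 3) → EuclideanSpace ℝ (Fin 3)) (p : ℝ → EuclideanSpace ℝ (Fin 3) → ℝ), Literature.Analysis.FluidPDE.IsMaximalSmoothSolution ν 0 u p T → Literature.Analysis.FluidPDE.IsLerayHopfOn T ν 0 (u 0) u → Literature.Analysis.FluidPDE.HasRapidSpatialDecay (u 0) → ∃ (c t₀ R : ℝ), 0 ≤ c ∧ 0 ≤ t₀ ∧ t₀ < T ∧ 0 < R ∧ ∀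 (M : ℝ), 1 ≤ M → ∀ t ∈ Set.Ico t₀ T, ∀ (x : EuclideanSpace ℝ (Fin 3)) (ρ : ℝ), 0 < ρ → M * ρ ≤ R → (⨆ z, ‖Literature.Analysis.FluidPDE.curl (u t) z‖) ≤ 2 * ‖Literature.Analysis.FluidPDE.curl (u t) x‖ → Metric.ball x ρ ⊆ {y | (⨆ z, ‖Literature.Analysis.FluidPDE.curl (u t) z‖) ≤ 4 * ‖Literature.Analysis.FluidPDE.curl (u t) y‖} → (∀ (x' : EuclideanSpace ℝ (Fin 3)) (ρ' : ℝ), (⨆ z, ‖Literature.Analysis.FluidPDE.curl (u t) z‖) ≤ 2 * ‖Literature.Analysis.FluidPDE.curl (u t) x'‖ → Metric.ball x' ρ' ⊆ {y | (⨆ z, ‖Literature.Analysis.FluidPDE.curl (u t) z‖) ≤ 4 * ‖Literature.Analysis.FluidPDE.curl (u t) y‖} → ρ' ≤ 2 * ρ) → ∀ e : EuclideanSpace ℝ (Fin 3), ‖e‖ = 1 → ∀ y ∈ Metric.ball x R \ Metric.ball x (M * ρ), ‖Literature.Analysis.FluidPDE.curl (u t) y - inner ℝ (Literature.Analysis.FluidPDE.curl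 (u t) y) e • e‖ ≤ c * ρ ^ 2 * (⨆ z, ‖Literature.Analysis.FluidPDE.curl (u t) z‖) * (‖x - y‖ ^ 2)⁻¹) → ∀ (ν T : ℝ), 0 < ν → 0 < T → ∀ (u : ℝ → EuclideanSpace ℝ (Fin 3) → EuclideanSpace ℝ (Fin 3)) (p : ℝ → EuclideanSpace ℝ (Fin 3) → ℝ), Literature.Analysis.FluidPDE.IsMaximalSmoothSolution ν 0 u p T → Literature.Analysis.FluidPDE.IsLerayHopfOn T ν 0 (u 0) u → Literature.Analysis.FluidPDE.HasRapidSpatialDecay (u 0) → ∃ (C t₀ R : ℝ) (g₁ : ℝ → ℝ), 0 ≤ C ∧ 0 ≤ t₀ ∧ t₀ < T ∧ 0 < R ∧ MeasureTheory.IntegrableOn g₁ (Set.Ico t₀ T) ∧ ∀ (M : ℝ), 1 ≤ M → ∀ t ∈ Set.Ico t₀ T, ∀ (x : EuclideanSpace ℝ (Fin 3)) (ρ : ℝ), 0 < ρ → M * ρ ≤ R → (⨆ z, ‖Literature.Analysis.FluidPDE.curl (u t) z‖) ≤ 2 * ‖Literature.Analysis.FluidPDE.curl (u t) x‖ → Metric.ball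 x ρ ⊆ {y | (⨆ z, ‖Literature.Analysis.FluidPDE.curl (u t) z‖) ≤ 4 * ‖Literature.Analysis.FluidPDE.curl (u t) y‖} → (∀ (x' : EuclideanSpace ℝ (Fin 3)) (ρ' : ℝ), (⨆ z, ‖Literature.Analysis.FluidPDE.curl (u t) z‖) ≤ 2 * ‖Literature.Analysis.FluidPDE.curl (u t) x'‖ → Metric.ball x' ρ' ⊆ {y | (⨆ z, ‖Literature.Analysis.FluidPDE.curl (u t) z‖) ≤ 4 * ‖Literature.Analysis.FluidPDE.curl (u t) y‖} → ρ' ≤ 2 * ρ) → ∀ e : EuclideanSpace ℝ (Fin 3), ‖e‖ = 1 → |inner ℝ ((fderiv ℝ (fun z : EuclideanSpace ℝ (Fin 3) => ∫ y, (4 * Real.pi * ‖z - y‖ ^ 3)⁻¹ • Literature.Analysis.FluidPDE.cross ((Metric.ball x R).indicator (Literature.Analysis.FluidPDE.curl (u t)) y) (z - y)) x - fderiv ℝ (fun z : EuclideanSpace ℝ (Fin 3) => ∫ y, (4 * Real.pi * ‖z - y‖ ^ 3)⁻¹ • Literature.Analysis.FluidPDE.cross ((Metric.ball x (M * ρ)).indicator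 (Literature.Analysis.FluidPDE.curl (u t)) y) (z - y)) x) e) e| ≤ C / M ^ 2 * (⨆ z, ‖Literature.Analysis.FluidPDE.curl (u t) z‖) + g₁ t := by
  intro hCoh ν T hν hT u p hmax hlh hdec
  obtain ⟨C, hC0, hC⟩ := shellStretch_abs_le_rate
  obtain ⟨c, t₀, R, hc, ht₀, ht₀T, hR, hH⟩ := hCoh ν T hν hT u p hmax hlh hdec
  refine ⟨C * c, t₀, R, fun _ => 0, mul_nonneg hC0 hc, ht₀, ht₀T, hR, integrableOn_zero, ?_⟩
  intro M hM t ht x ρ hρ hMR hpeak hball hmaxrad e he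
  have ht' : t ∈ Set.Ico 0 T := ⟨ht₀.trans ht.1, ht.2⟩
  have hsm : ContDiff ℝ ∞ (u t) := hmax.1.contDiff_velocity ht'
  have hΩ : 0 ≤ ⨆ z, ‖Literature.Analysis.FluidPDE.curl (u t) z‖ := iSup_norm_curl_nonneg (u t)
  have hM0 : 0 < M := by linarith
  have hdec' : ∀ y ∈ Metric.ball x R \ Metric.ball x (M * ρ),
      ‖Literature.Analysis.FluidPDE.curl (u t) y - inner ℝ (Literature.Analysis.FluidPDE.curl (u t) y) e • e‖ ≤
        (c * ⨆ z, ‖Literature.Analysis.FluidPDE.curl (u t) z‖) * ρ ^ 2 * (‖x - y‖ ^ 2)⁻¹ := by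
    intro y hy
    have h := hH M hM t ht x ρ hρ hMR hpeak hball hmaxrad e he y hy
    calc ‖Literature.Analysis.FluidPDE.curl (u t) y - inner ℝ (Literature.Analysis.FluidPDE.curl (u t) y) e • e‖
        ≤ c * ρ ^ 2 * (⨆ z, ‖Literature.Analysis.FluidPDE.curl (u t) z‖) * (‖x - y‖ ^ 2)⁻¹ := h
      _ = (c * ⨆ z, ‖Literature.Analysis.FluidPDE.curl (u t) z‖) * ρ ^ 2 * (‖x - y‖ ^ 2)⁻¹ := by ring
  have hb := hC (u t) x ρ M R e (c * ⨆ z, ‖Literature.Analysis.FluidPDE.curl (u t) z‖) hsm hρ hM0 hMR he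
    (mul_nonneg hc hΩ) hdec'
  refine hb.trans_eq ?_
  show C * (c * ⨆ z, ‖Literature.Analysis.FluidPDE.curl (u t) z‖) / M ^ 2 =
    C * c / M ^ 2 * (⨆ z, ‖Literature.Analysis.FluidPDE.curl (u t) z‖) + 0
  ring

/-- **Depleted integral rate ⇒ rate-form shell locality (registered stub `shellRate_of_depletedShellRate`).** If every
maximal finite-energy classical solution from Clay data admits `C ≥ 0`, `t₀ < T`, `R > 0` and an integrable `g₁` with,
for all `M ≥ 1`, at every admissible `(t,x,ρ)` with `Mρ ≤ R` and every unit `e`,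
`∫_{B(x,R) ∖ B(x,Mρ)} ‖ω(t,y) − ⟪ω(t,y),e⟫e‖ |x − y|⁻³ dy ≤ C/M² · Ω(t) + g₁(t)`, then `ShellRate2` holds with
`(A C, A g₁)`, `A` the absolute constant of `Depletion.shellStretch_abs_le_depleted`. [folklore] -/
theorem shellRate_of_depletedShellRate : (∀ (ν T : ℝ), 0 < ν → 0 < T → ∀ (u : ℝ → EuclideanSpace ℝ (Fin 3) → EuclideanSpace ℝ (Fin 3)) (p : ℝ → EuclideanSpace ℝ (Fin 3) → ℝ), Literature.Analysis.FluidPDE.IsMaximalSmoothSolution ν 0 u p T → Literature.Analysis.FluidPDE.IsLerayHopfOn T ν 0 (u 0) u → Literature.Analysis.FluidPDE.HasRapidSpatialDecay (u 0) → ∃ (C t₀ R : ℝ) (g₁ : ℝ → ℝ), 0 ≤ C ∧ 0 ≤ t₀ ∧ t₀ < T ∧ 0 < R ∧ MeasureTheory.IntegrableOn g₁ (Set.Ico t₀ T) ∧ ∀ (M : ℝ), 1 ≤ M → ∀ t ∈ Set.Ico t₀ T, ∀ (x : EuclideanSpace ℝ (Fin 3)) (ρ : ℝ), 0 < ρ →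 M * ρ ≤ R → (⨆ z, ‖Literature.Analysis.FluidPDE.curl (u t) z‖) ≤ 2 * ‖Literature.Analysis.FluidPDE.curl (u t) x‖ → Metric.ball x ρ ⊆ {y | (⨆ z, ‖Literature.Analysis.FluidPDE.curl (u t) z‖) ≤ 4 * ‖Literature.Analysis.FluidPDE.curl (u t) y‖} → (∀ (x' : EuclideanSpace ℝ (Fin 3)) (ρ' : ℝ), (⨆ z, ‖Literature.Analysis.FluidPDE.curl (u t) z‖) ≤ 2 * ‖Literature.Analysis.FluidPDE.curl (u t) x'‖ → Metric.ball x' ρ' ⊆ {y | (⨆ z, ‖Literature.Analysis.FluidPDE.curl (u t) z‖) ≤ 4 * ‖Literature.Analysis.FluidPDE.curl (u t) y‖} → ρ' ≤ 2 * ρ) → ∀ e : EuclideanSpace ℝ (Fin 3), ‖e‖ = 1 → ∫ y in Metric.ball x R \ Metric.ball x (M * ρ), ‖Literature.Analysis.FluidPDE.curl (u t) y - inner ℝ (Literature.Analysis.FluidPDE.curl (u t) y) e • e‖ * (‖x - y‖ ^ 3)⁻¹ ≤ C / M ^ 2 * (⨆ z, ‖Literature.Analysis.FluidPDE.curl (u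 t) z‖) + g₁ t) → ∀ (ν T : ℝ), 0 < ν → 0 < T → ∀ (u : ℝ → EuclideanSpace ℝ (Fin 3) → EuclideanSpace ℝ (Fin 3)) (p : ℝ → EuclideanSpace ℝ (Fin 3) → ℝ), Literature.Analysis.FluidPDE.IsMaximalSmoothSolution ν 0 u p T → Literature.Analysis.FluidPDE.IsLerayHopfOn T ν 0 (u 0) u → Literature.Analysis.FluidPDE.HasRapidSpatialDecay (u 0) → ∃ (C t₀ R : ℝ) (g₁ : ℝ → ℝ), 0 ≤ C ∧ 0 ≤ t₀ ∧ t₀ < T ∧ 0 < R ∧ MeasureTheory.IntegrableOn g₁ (Set.Ico t₀ T) ∧ ∀ (M : ℝ), 1 ≤ M → ∀ t ∈ Set.Ico t₀ T, ∀ (x : EuclideanSpace ℝ (Fin 3)) (ρ : ℝ), 0 < ρ → M * ρ ≤ R → (⨆ z, ‖Literature.Analysis.FluidPDE.curl (u t) z‖) ≤ 2 * ‖Literature.Analysis.FluidPDE.curl (u t) x‖ → Metric.ball x ρ ⊆ {y | (⨆ z, ‖Literature.Analysis.FluidPDE.curl (u t) z‖) ≤ 4 * ‖Literature.Analysis.FluidPDE.curl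 (u t) y‖} → (∀ (x' : EuclideanSpace ℝ (Fin 3)) (ρ' : ℝ), (⨆ z, ‖Literature.Analysis.FluidPDE.curl (u t) z‖) ≤ 2 * ‖Literature.Analysis.FluidPDE.curl (u t) x'‖ → Metric.ball x' ρ' ⊆ {y | (⨆ z, ‖Literature.Analysis.FluidPDE.curl (u t) z‖) ≤ 4 * ‖Literature.Analysis.FluidPDE.curl (u t) y‖} → ρ' ≤ 2 * ρ) → ∀ e : EuclideanSpace ℝ (Fin 3), ‖e‖ = 1 → |inner ℝ ((fderiv ℝ (fun z : EuclideanSpace ℝ (Fin 3) => ∫ y, (4 * Real.pi * ‖z - y‖ ^ 3)⁻¹ • Literature.Analysis.FluidPDE.cross ((Metric.ball x R).indicator (Literature.Analysis.FluidPDE.curl (u t)) y) (z - y)) x - fderiv ℝ (fun z : EuclideanSpace ℝ (Fin 3) => ∫ y, (4 * Real.pi * ‖z - y‖ ^ 3)⁻¹ • Literature.Analysis.FluidPDE.cross ((Metric.ball x (M * ρ)).indicator (Literature.Analysis.FluidPDE.curl (u t)) y) (z - y)) x) e) e| ≤ C / M ^ 2 * (⨆ z, ‖Literature.Analysis.FluidPDE.curl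 (u t) z‖) + g₁ t := by
  intro hD ν T hν hT u p hmax hlh hdec
  obtain ⟨A, hA0, hA⟩ := shellStretch_abs_le_depleted
  obtain ⟨C, t₀, R, g₁, hC, ht₀, ht₀T, hR, hg₁, hH⟩ := hD ν T hν hT u p hmax hlh hdec
  refine ⟨A * C, t₀, R, fun t => A * g₁ t, mul_nonneg hA0 hC, ht₀, ht₀T, hR, hg₁.integrable.const_mul A, ?_⟩
  intro M hM t ht x ρ hρ hMR hpeak hball hmaxrad e he
  have ht' : t ∈ Set.Ico 0 T := ⟨ht₀.trans ht.1, ht.2⟩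
  have hsm : ContDiff ℝ ∞ (u t) := hmax.1.contDiff_velocity ht'
  have hM0 : 0 < M := by linarith
  have hb := hA (u t) x (M * ρ) R e hsm (mul_pos hM0 hρ) hMR he
  have hI := hH M hM t ht x ρ hρ hMR hpeak hball hmaxrad e he
  refine (hb.trans (mul_le_mul_of_nonneg_left hI hA0)).trans_eq ?_
  show A * (C / M ^ 2 * (⨆ z, ‖Literature.Analysis.FluidPDE.curl (u t) z‖) + g₁ t) =
    A * C / M ^ 2 * (⨆ z, ‖Literature.Analysis.FluidPDE.curl (u t) z‖) + A * g₁ t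
  ring

/-- **Pointwise direction coherence across the shell ⇒ the re-typed crux `B_rate2`** (composition with the landed
far-field reduction `Rate.bRate_of_shellRate`, p158280). [folklore] -/
theorem bRate_of_shellCoherence : (∀ (ν T : ℝ), 0 < ν → 0 < T → ∀ (u : ℝ → EuclideanSpace ℝ (Fin 3) → EuclideanSpace ℝ (Fin 3)) (p : ℝ → EuclideanSpace ℝ (Fin 3) → ℝ), Literature.Analysis.FluidPDE.IsMaximalSmoothSolution ν 0 u p T → Literature.Analysis.FluidPDE.IsLerayHopfOn T ν 0 (u 0) u → Literature.Analysis.FluidPDE.HasRapidSpatialDecay (u 0) → ∃ (c t₀ R : ℝ), 0 ≤ c ∧ 0 ≤ t₀ ∧ t₀ < T ∧ 0 < R ∧ ∀ (M : ℝ), 1 ≤ M → ∀ t ∈ Set.Ico t₀ T, ∀ (x : EuclideanSpace ℝ (Fin 3)) (ρ : ℝ), 0 < ρ → M * ρ ≤ R → (⨆ z, ‖Literature.Analysis.FluidPDE.curl (u t) z‖) ≤ 2 * ‖Literature.Analysis.FluidPDE.curl (u t) x‖ → Metric.ball x ρ ⊆ {y | (⨆ z, ‖Literature.Analysis.FluidPDE.curl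 (u t) z‖) ≤ 4 * ‖Literature.Analysis.FluidPDE.curl (u t) y‖} → (∀ (x' : EuclideanSpace ℝ (Fin 3)) (ρ' : ℝ), (⨆ z, ‖Literature.Analysis.FluidPDE.curl (u t) z‖) ≤ 2 * ‖Literature.Analysis.FluidPDE.curl (u t) x'‖ → Metric.ball x' ρ' ⊆ {y | (⨆ z, ‖Literature.Analysis.FluidPDE.curl (u t) z‖) ≤ 4 * ‖Literature.Analysis.FluidPDE.curl (u t) y‖} → ρ' ≤ 2 * ρ) → ∀ e : EuclideanSpace ℝ (Fin 3), ‖e‖ = 1 → ∀ y ∈ Metric.ball x R \ Metric.ball x (M * ρ), ‖Literature.Analysis.FluidPDE.curl (u t) y - inner ℝ (Literature.Analysis.FluidPDE.curl (u t) y) e • e‖ ≤ c * ρ ^ 2 * (⨆ z, ‖Literature.Analysis.FluidPDE.curl (u t) z‖) * (‖x - y‖ ^ 2)⁻¹) → ∀ (ν T : ℝ), 0 < ν → 0 < T → ∀ (u : ℝ → EuclideanSpace ℝ (Fin 3) → EuclideanSpace ℝ (Fin 3)) (p : ℝ → EuclideanSpace ℝ (Fin 3) → ℝ), Literature.Analysis.FluidPDE.IsMaximalSmoothSolution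 ν 0 u p T → Literature.Analysis.FluidPDE.IsLerayHopfOn T ν 0 (u 0) u → Literature.Analysis.FluidPDE.HasRapidSpatialDecay (u 0) → ∃ (C t₀ : ℝ) (g : ℝ → ℝ), 0 ≤ C ∧ 0 ≤ t₀ ∧ t₀ < T ∧ MeasureTheory.IntegrableOn g (Set.Ico t₀ T) ∧ ∀ (M : ℝ), 1 ≤ M → ∀ t ∈ Set.Ico t₀ T, ∀ (x : EuclideanSpace ℝ (Fin 3)) (ρ : ℝ), 0 < ρ → (⨆ z, ‖Literature.Analysis.FluidPDE.curl (u t) z‖) ≤ 2 * ‖Literature.Analysis.FluidPDE.curl (u t) x‖ → Metric.ball x ρ ⊆ {y | (⨆ z, ‖Literature.Analysis.FluidPDE.curl (u t) z‖) ≤ 4 * ‖Literature.Analysis.FluidPDE.curl (u t) y‖} → (∀ (x' : EuclideanSpace ℝ (Fin 3)) (ρ' : ℝ), (⨆ z, ‖Literature.Analysis.FluidPDE.curl (u t) z‖) ≤ 2 * ‖Literature.Analysis.FluidPDE.curl (u t) x'‖ → Metric.ball x' ρ' ⊆ {y | (⨆ z, ‖Literature.Analysis.FluidPDE.curl (u t)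 z‖) ≤ 4 * ‖Literature.Analysis.FluidPDE.curl (u t) y‖} → ρ' ≤ 2 * ρ) → ∀ e : EuclideanSpace ℝ (Fin 3), ‖e‖ = 1 → |inner ℝ ((fderiv ℝ (u t) x - fderiv ℝ (fun z : EuclideanSpace ℝ (Fin 3) => ∫ y, (4 * Real.pi * ‖z - y‖ ^ 3)⁻¹ • Literature.Analysis.FluidPDE.cross ((Metric.ball x (M * ρ)).indicator (Literature.Analysis.FluidPDE.curl (u t)) y) (z - y)) x) e) e| ≤ C / M ^ 2 * (⨆ z, ‖Literature.Analysis.FluidPDE.curl (u t) z‖) + g t :=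
  fun h => bRate_of_shellRate (shellRate_of_shellCoherence h)

/-- **Depleted integral rate ⇒ the re-typed crux `B_rate2`** (composition with `Rate.bRate_of_shellRate`). [folklore] -/
theorem bRate_of_depletedShellRate : (∀ (ν T : ℝ), 0 < ν → 0 < T → ∀ (u : ℝ → EuclideanSpace ℝ (Fin 3) → EuclideanSpace ℝ (Fin 3)) (p : ℝ → EuclideanSpace ℝ (Fin 3) → ℝ), Literature.Analysis.FluidPDE.IsMaximalSmoothSolution ν 0 u p T → Literature.Analysis.FluidPDE.IsLerayHopfOn T ν 0 (u 0) u → Literature.Analysis.FluidPDE.HasRapidSpatialDecay (u 0) → ∃ (C t₀ R : ℝ) (g₁ : ℝ → ℝ), 0 ≤ C ∧ 0 ≤ t₀ ∧ t₀ < T ∧ 0 < R ∧ MeasureTheory.IntegrableOn g₁ (Set.Ico t₀ T) ∧ ∀ (M : ℝ), 1 ≤ M → ∀ t ∈ Set.Ico t₀ T, ∀ (x : EuclideanSpace ℝ (Fin 3)) (ρ : ℝ), 0 < ρ → M * ρ ≤ R → (⨆ z, ‖Literature.Analysis.FluidPDE.curl (u t) z‖) ≤ 2 * ‖Literature.Analysis.FluidPDE.curl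 (u t) x‖ → Metric.ball x ρ ⊆ {y | (⨆ z, ‖Literature.Analysis.FluidPDE.curl (u t) z‖) ≤ 4 * ‖Literature.Analysis.FluidPDE.curl (u t) y‖} → (∀ (x' : EuclideanSpace ℝ (Fin 3)) (ρ' : ℝ), (⨆ z, ‖Literature.Analysis.FluidPDE.curl (u t) z‖) ≤ 2 * ‖Literature.Analysis.FluidPDE.curl (u t) x'‖ → Metric.ball x' ρ' ⊆ {y | (⨆ z, ‖Literature.Analysis.FluidPDE.curl (u t) z‖) ≤ 4 * ‖Literature.Analysis.FluidPDE.curl (u t) y‖} → ρ' ≤ 2 * ρ) → ∀ e : EuclideanSpace ℝ (Fin 3), ‖e‖ = 1 → ∫ y in Metric.ball x R \ Metric.ball x (M * ρ), ‖Literature.Analysis.FluidPDE.curl (u t) y - inner ℝ (Literature.Analysis.FluidPDE.curl (u t) y) e • e‖ * (‖x - y‖ ^ 3)⁻¹ ≤ C / M ^ 2 * (⨆ z, ‖Literature.Analysis.FluidPDE.curl (u t) z‖) + g₁ t) → ∀ (ν T : ℝ), 0 < ν → 0 < T → ∀ (u : ℝ → EuclideanSpace ℝ (Fin 3) → EuclideanSpace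 ℝ (Fin 3)) (p : ℝ → EuclideanSpace ℝ (Fin 3) → ℝ), Literature.Analysis.FluidPDE.IsMaximalSmoothSolution ν 0 u p T → Literature.Analysis.FluidPDE.IsLerayHopfOn T ν 0 (u 0) u → Literature.Analysis.FluidPDE.HasRapidSpatialDecay (u 0) → ∃ (C t₀ : ℝ) (g : ℝ → ℝ), 0 ≤ C ∧ 0 ≤ t₀ ∧ t₀ < T ∧ MeasureTheory.IntegrableOn g (Set.Ico t₀ T) ∧ ∀ (M : ℝ), 1 ≤ M → ∀ t ∈ Set.Ico t₀ T, ∀ (x : EuclideanSpace ℝ (Fin 3)) (ρ : ℝ), 0 < ρ → (⨆ z, ‖Literature.Analysis.FluidPDE.curl (u t) z‖) ≤ 2 * ‖Literature.Analysis.FluidPDE.curl (u t) x‖ → Metric.ball x ρ ⊆ {y | (⨆ z, ‖Literature.Analysis.FluidPDE.curl (u t) z‖) ≤ 4 * ‖Literature.Analysis.FluidPDE.curl (u t) y‖} → (∀ (x' : EuclideanSpace ℝ (Fin 3)) (ρ' : ℝ), (⨆ z, ‖Literature.Analysis.FluidPDE.curl (u t) z‖) ≤ 2 * ‖Literature.Analysis.FluidPDE.curl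 (u t) x'‖ → Metric.ball x' ρ' ⊆ {y | (⨆ z, ‖Literature.Analysis.FluidPDE.curl (u t) z‖) ≤ 4 * ‖Literature.Analysis.FluidPDE.curl (u t) y‖} → ρ' ≤ 2 * ρ) → ∀ e : EuclideanSpace ℝ (Fin 3), ‖e‖ = 1 → |inner ℝ ((fderiv ℝ (u t) x - fderiv ℝ (fun z : EuclideanSpace ℝ (Fin 3) => ∫ y, (4 * Real.pi * ‖z - y‖ ^ 3)⁻¹ • Literature.Analysis.FluidPDE.cross ((Metric.ball x (M * ρ)).indicator (Literature.Analysis.FluidPDE.curl (u t)) y) (z - y)) x) e) e| ≤ C / M ^ 2 * (⨆ z, ‖Literature.Analysis.FluidPDE.curl (u t) z‖) + g t :=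
  fun h => bRate_of_shellRate (shellRate_of_depletedShellRate h)

end Summit.NavierStokesRegularity.NavierStokesRegularity.Theorems.BlowupIsLocallyDriven.Depletion
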